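import Summits.CriticalPhenomena.Ising3DConformalLimit.Theorems.EnergyNotSigmaSquaredMoebiusLimitExistsSepMoveAux
import HarnessLib

/-!
# Reflection-positivity transfer: asymptotic equicontinuity of the pinned zoom under moves of a
coordinate-separated point
(stub `sepMove_equicontinuity` of line `only-interaction-breaks-moebius` for the crux `MoebiusLimitExists`,
item stmt-CriticalPhenomena-1344, route `EnergyNotSigmaSquared`)

Granted the lattice RP move inequality (the statement of `moveIneq_latticeRP`, taken as a
hypothesis) and the two-point law `⟨σ₀σ_y⟩_{β_c}‖y‖₂^{2Δ} → c > 0` (item stmt-0634, data), the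
pinned rescaled critical correlators `F_k = ρ_pin(u k)ᴺ ⟨∏ σ_{[x_j/u k]}⟩_{β_c}` along a mesh
sequence `u k → 0⁺` are asymptotically equicontinuous, uniformly on compact sets of non-coincident
configurations, under moves of ONE point separated from all the others by a coordinate slab of
macroscopic width `κ`.

Proof (by contradiction along sequences, `equicontinuity_of_seq` of `…SepMoveAux.lean`). Along
`x_j, x'_j → x₀` put the lattice mirror at height `c_j = ⌊(x_j i τ ± κ/2)/δ_j⌋`; the move inequality
bounds `(F x_j − F x'_j)²` by `[ρ²G(v₀) − 2ρ²G(v₁) + ρ²G(v₂)] · ρ^{2n}⟨σ_{θB}σ_B⟩`. The three rescaled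
two-point terms have the SAME limit `‖r‖^{-2Δ}`, `r = (2 x₀ i τ − 2 m₀) e_τ ≠ 0`
(`tendsto_rhoPin_sq_mul_criticalTwoPoint`), so the bracket tends to `0`; the second factor is the
pinned zoom of order `2n` at the continuum lifts `δ_j (θB_j, B_j) → (θ_∞B₀, B₀)`, a NON-COINCIDENT
configuration (the two blocks lie on opposite strict sides of the limiting mirror,
`doubled_mem_nonCoincident`), hence eventually bounded by `pinnedZoomLocallyBounded` (Newman's
Gaussian inequality) on a compact ball around the limit.

References: J. Fröhlich, R. Israel, E. H. Lieb, B. Simon, Comm. Math. Phys. 62 (1978), §2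
[FILS1978]; H. Duminil-Copin, ICM 2022, §8.1 [DuminilCopinICM2022]. No definitions are introduced.
-/

noncomputable section

open Filter Topology Set Function
open Literature.Probability.LatticeModels

namespace Summit.CriticalPhenomena.Ising3DConformalLimit.MoebiusLimitExistsOnlyInteraction

/-! ### The sequential core -/

/-- **Sequential core of the RP transfer.** Along a mesh sequence `u j → 0⁺` and configurations
`x_j, x'_j → x₀` (non-coincident) differing only at `i`, with lattice mirror heights `c_j`,
`u_j c_j → m₀ ≠ x₀ i τ`, all other limit points on one strict side of `{p_τ = m₀}`, and the lattice
side conditions of the move inequality holding eventually: `F_j x_j − F_j x'_j → 0`. The bracket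
`ρ²G(v₀) − 2ρ²G(v₁) + ρ²G(v₂)` tends to `κ' − 2κ' + κ' = 0` (`tendsto_rhoPin_sq_mul_criticalTwoPoint`,
the three rescaled vectors tend to `(2x₀ i τ − 2m₀)e_τ ≠ 0`), and the doubled factor
`ρ^{2n}⟨σ_{θB}σ_B⟩` is the pinned zoom at the lifts `u_j(θB_j, B_j) → (θ_∞B₀, B₀)`, eventually
bounded (`pinnedZoomLocallyBounded` on a compact ball inside `NonCoincident`).
[cite: FILS1978, §2] -/
theorem tendsto_sub_of_move {Δ c : ℝ} (hc : 0 < c)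
    (hG : Tendsto (fun y : Site 3 => criticalTwoPoint 3 y * Real.sqrt (∑ i, ((y i : ℝ)) ^ 2) ^ (2 * Δ))
      cofinite (𝓝 c))
    {u : ℕ → ℝ} (hu : Tendsto u atTop (𝓝[>] (0 : ℝ))) {n : ℕ} (i : Fin (n + 1)) (τ : Fin 3)
    (hMove : ∀ (c : ℤ) (y y' : Fin (n + 1) → Site 3),
      (∀ j, j ≠ i → y' j = y j) →
      ((y i τ ≤ c ∧ y' i τ ≤ c ∧ ∀ j, j ≠ i → c ≤ y j τ) ∨
        (c ≤ y i τ ∧ c ≤ y' i τ ∧ ∀ j, j ≠ i → y j τ ≤ c)) →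
      (criticalCorr 3 (n + 1) y - criticalCorr 3 (n + 1) y') ^ 2 ≤
        (criticalTwoPoint 3 (y i - Function.update (y i) τ (2 * c - y i τ))
          - 2 * criticalTwoPoint 3 (y i - Function.update (y' i) τ (2 * c - y' i τ))
          + criticalTwoPoint 3 (y' i - Function.update (y' i) τ (2 * c - y' i τ))) *
        criticalCorr 3 (n + n)
          (Fin.append (fun j => Function.update (y (i.succAbove j)) τ (2 * c - y (i.succAbove j) τ))
            (fun j => y (i.succAbove j))))
    {x x' : ℕ → Fin (n + 1) → EuclideanSpace ℝ (Fin 3)} {x₀ : Fin (n + 1) → EuclideanSpace ℝ (Fin 3)}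
    (hx : Tendsto x atTop (𝓝 x₀)) (hx' : Tendsto x' atTop (𝓝 x₀)) (hinj : Injective x₀)
    (hdiff : ∀ j l, l ≠ i → x' j l = x j l) {cs : ℕ → ℤ} {m₀ : ℝ}
    (hcs : Tendsto (fun j => u j * (cs j : ℝ)) atTop (𝓝 m₀)) (hm₀ : x₀ i τ ≠ m₀)
    (hside₀ : (∀ l, l ≠ i → m₀ < x₀ l τ) ∨ (∀ l, l ≠ i → x₀ l τ < m₀))
    (hside : ∀ᶠ j in atTop,
      (latticeApprox (u j) (x j i) τ ≤ cs j ∧ latticeApprox (u j) (x' j i) τ ≤ cs j ∧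
          ∀ l, l ≠ i → cs j ≤ latticeApprox (u j) (x j l) τ) ∨
        (cs j ≤ latticeApprox (u j) (x j i) τ ∧ cs j ≤ latticeApprox (u j) (x' j i) τ ∧
          ∀ l, l ≠ i → latticeApprox (u j) (x j l) τ ≤ cs j)) :
    Tendsto (fun j => rescaledCorrelator (criticalCorr 3) rhoPin (n + 1) (u j) (x j) -
      rescaledCorrelator (criticalCorr 3) rhoPin (n + 1) (u j) (x' j)) atTop (𝓝 0) := by
  have hupos : ∀ᶠ j in atTop, 0 < u j := (tendsto_nhdsWithin_iff.1 hu).2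
  -- rescaled coordinates of the lattice approximations converge
  have hco : ∀ z : ℕ → Fin (n + 1) → EuclideanSpace ℝ (Fin 3), Tendsto z atTop (𝓝 x₀) →
      ∀ l q, Tendsto (fun j => u j * (latticeApprox (u j) (z j l) q : ℝ)) atTop (𝓝 (x₀ l q)) := by
    intro z hz l q
    have hc' : Continuous fun w : Fin (n + 1) → EuclideanSpace ℝ (Fin 3) => w l q := by fun_prop
    have h := tendsto_mul_floor_div hu ((hc'.tendsto x₀).comp hz)
    simpa only [latticeApprox_apply, Function.comp_def] using h
  -- FIRST FACTOR: the three rescaled two-point terms have the same limit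
  have hr : (EuclideanSpace.single τ (2 * x₀ i τ - 2 * m₀) : EuclideanSpace ℝ (Fin 3)) ≠ 0 := by
    rw [Ne, PiLp.single_eq_zero_iff]
    intro h
    exact hm₀ (by linarith)
  have hpair : ∀ a b : ℕ → Site 3,
      (∀ q, Tendsto (fun j => u j * (a j q : ℝ)) atTop (𝓝 (x₀ i q))) →
      (∀ q, Tendsto (fun j => u j * (b j q : ℝ)) atTop (𝓝 (x₀ i q))) →
      Tendsto (fun j => rhoPin (u j) ^ 2 *
        criticalTwoPoint 3 (a j - Function.update (b j) τ (2 * cs j - b j τ))) atTop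
        (𝓝 (‖(EuclideanSpace.single τ (2 * x₀ i τ - 2 * m₀) : EuclideanSpace ℝ (Fin 3))‖ ^
          (-(2 * Δ)))) := by
    intro a b ha hb
    refine tendsto_rhoPin_sq_mul_criticalTwoPoint hc hG hu hr fun q => ?_
    have hlim : (EuclideanSpace.single τ (2 * x₀ i τ - 2 * m₀) : EuclideanSpace ℝ (Fin 3)) q =
        x₀ i q - (if q = τ then 2 * m₀ - x₀ i τ else x₀ i q) := by
      rw [PiLp.single_apply]
      split_ifs with hq
      · subst hq; ring
      · ring
    rw [hlim]
    refine ((ha q).sub (tendsto_mul_update_apply τ hb hcs q)).congr fun j => ?_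
    rw [Pi.sub_apply, Int.cast_sub, mul_sub]
  have hxi := hco x hx i
  have hx'i := hco x' hx' i
  have hA := ((hpair _ _ hxi hxi).sub ((hpair _ _ hxi hx'i).const_mul 2)).add (hpair _ _ hx'i hx'i)
  rw [show ∀ t : ℝ, t - 2 * t + t = 0 from fun t => by ring] at hA
  -- SECOND FACTOR: the doubled configuration, its lifts and their limit
  obtain ⟨Zl, hZl⟩ : ∃ Zl : ℕ → Fin (n + n) → Site 3, ∀ j, Zl j = Fin.append
      (fun l => Function.update (latticeApprox (u j) (x j (i.succAbove l))) τ
        (2 * cs j - latticeApprox (u j) (x j (i.succAbove l)) τ))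
      (fun l => latticeApprox (u j) (x j (i.succAbove l))) := ⟨_, fun _ => rfl⟩
  obtain ⟨Z₀, hZ₀⟩ : ∃ Z₀ : Fin (n + n) → EuclideanSpace ℝ (Fin 3), Z₀ = Fin.append
      (fun l => (WithLp.toLp 2 fun q => if q = τ then 2 * m₀ - x₀ (i.succAbove l) τ
        else x₀ (i.succAbove l) q : EuclideanSpace ℝ (Fin 3)))
      (fun l => x₀ (i.succAbove l)) := ⟨_, rfl⟩
  have hZlim : Tendsto (fun j => fun a => (u j • siteVec (Zl j a) : EuclideanSpace ℝ (Fin 3)))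
      atTop (𝓝 Z₀) := by
    refine tendsto_pi_nhds.2 fun a => tendsto_euclidean_of_apply fun q => ?_
    simp only [PiLp.smul_apply, siteVec_apply, smul_eq_mul, hZl, hZ₀]
    induction a using Fin.addCases with
    | left l =>
      simp only [Fin.append_left, PiLp.toLp_apply]
      exact tendsto_mul_update_apply τ (hco x hx (i.succAbove l)) hcs q
    | right l =>
      simp only [Fin.append_right]
      exact hco x hx (i.succAbove l) q
  have hZ₀mem : Z₀ ∈ NonCoincident 3 (n + n) := hZ₀ ▸ doubled_mem_nonCoincident i τ hinj hside₀
  obtain ⟨ε₀, hε₀, hball⟩ := Metric.isOpen_iff.1 (isOpen_nonCoincident 3 (n + n)) Z₀ hZ₀mem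
  obtain ⟨B, hB⟩ := pinnedZoomLocallyBounded Δ c hc hG u hu (n + n)
    (Metric.closedBall Z₀ (ε₀ / 2)) (isCompact_closedBall Z₀ (ε₀ / 2))
    ((Metric.closedBall_subset_ball (half_lt_self hε₀)).trans hball)
  have hmem : ∀ᶠ j in atTop, (fun a => (u j • siteVec (Zl j a) : EuclideanSpace ℝ (Fin 3))) ∈
      Metric.closedBall Z₀ (ε₀ / 2) :=
    hZlim.eventually_mem (Metric.closedBall_mem_nhds Z₀ (half_pos hε₀))
  have hbound : ∀ᶠ j in atTop, |rhoPin (u j) ^ (n + n) * criticalCorr 3 (n + n) (Zl j)| ≤ B := by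
    filter_upwards [hB, hmem, hupos] with j hBj hmj hposj
    have h := hBj _ hmj
    simp only [rescaledCorrelator_apply, latticeApprox_smul_siteVec hposj] at h
    exact h
  -- COMBINATION
  have hsq : Tendsto (fun j => (rescaledCorrelator (criticalCorr 3) rhoPin (n + 1) (u j) (x j) -
      rescaledCorrelator (criticalCorr 3) rhoPin (n + 1) (u j) (x' j)) ^ 2) atTop (𝓝 0) := by
    refine squeeze_zero' (Eventually.of_forall fun j => sq_nonneg _) ?_
      (by simpa using hA.abs.mul_const B)
    filter_upwards [hside, hbound] with j hsj hbj
    have h := sq_rescaled_sub_le_of_move i τ hMove (u j) (cs j) (x j) (x' j) (hdiff j) hsj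
    rw [← hZl j] at h
    refine h.trans ((le_abs_self _).trans ?_)
    rw [abs_mul]
    exact mul_le_mul_of_nonneg_left hbj (abs_nonneg _)
  rw [tendsto_zero_iff_abs_tendsto_zero]
  have h := hsq.sqrt
  rw [Real.sqrt_zero] at h
  exact h.congr fun j => Real.sqrt_sq_eq_abs _


/-- **Sequential form of the stub.** Along a mesh sequence and configurations `x_j, x'_j → x₀`
(non-coincident) differing only at `i`, with `x_j i` separated from the other points of `x_j` by a
slab of width `κ` in coordinate `τ` (fixed orientation), `F_j x_j − F_j x'_j → 0`: the core
`tendsto_sub_of_move` with the mirror at `c_j = ⌊(x_j i τ ± κ/2)/u_j⌋`, whose side conditions hold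
as soon as `|x'_j i τ − x_j i τ| < κ/2` (monotonicity of `⌊·⌋`). [cite: FILS1978, §2] -/
theorem tendsto_sub_of_separated {Δ c : ℝ} (hc : 0 < c)
    (hG : Tendsto (fun y : Site 3 => criticalTwoPoint 3 y * Real.sqrt (∑ i, ((y i : ℝ)) ^ 2) ^ (2 * Δ))
      cofinite (𝓝 c))
    {u : ℕ → ℝ} (hu : Tendsto u atTop (𝓝[>] (0 : ℝ))) {n : ℕ} (i : Fin (n + 1)) (τ : Fin 3)
    (hMove : ∀ (c : ℤ) (y y' : Fin (n + 1) → Site 3),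
      (∀ j, j ≠ i → y' j = y j) →
      ((y i τ ≤ c ∧ y' i τ ≤ c ∧ ∀ j, j ≠ i → c ≤ y j τ) ∨
        (c ≤ y i τ ∧ c ≤ y' i τ ∧ ∀ j, j ≠ i → y j τ ≤ c)) →
      (criticalCorr 3 (n + 1) y - criticalCorr 3 (n + 1) y') ^ 2 ≤
        (criticalTwoPoint 3 (y i - Function.update (y i) τ (2 * c - y i τ))
          - 2 * criticalTwoPoint 3 (y i - Function.update (y' i) τ (2 * c - y' i τ))
          + criticalTwoPoint 3 (y' i - Function.update (y' i) τ (2 * c - y' i τ))) *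
        criticalCorr 3 (n + n)
          (Fin.append (fun j => Function.update (y (i.succAbove j)) τ (2 * c - y (i.succAbove j) τ))
            (fun j => y (i.succAbove j))))
    {κ : ℝ} (hκ : 0 < κ)
    {x x' : ℕ → Fin (n + 1) → EuclideanSpace ℝ (Fin 3)} {x₀ : Fin (n + 1) → EuclideanSpace ℝ (Fin 3)}
    (hx : Tendsto x atTop (𝓝 x₀)) (hx' : Tendsto x' atTop (𝓝 x₀)) (hinj : Injective x₀)
    (hdiff : ∀ j l, l ≠ i → x' j l = x j l)
    (hsep : (∀ j l, l ≠ i → x j i τ + κ ≤ x j l τ) ∨ (∀ j l, l ≠ i → x j l τ + κ ≤ x j i τ)) :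
    Tendsto (fun j => rescaledCorrelator (criticalCorr 3) rhoPin (n + 1) (u j) (x j) -
      rescaledCorrelator (criticalCorr 3) rhoPin (n + 1) (u j) (x' j)) atTop (𝓝 0) := by
  have hupos : ∀ᶠ j in atTop, 0 < u j := (tendsto_nhdsWithin_iff.1 hu).2
  have hco : ∀ z : ℕ → Fin (n + 1) → EuclideanSpace ℝ (Fin 3), Tendsto z atTop (𝓝 x₀) →
      ∀ l q, Tendsto (fun j => z j l q) atTop (𝓝 (x₀ l q)) := by
    intro z hz l q
    have hc' : Continuous fun w : Fin (n + 1) → EuclideanSpace ℝ (Fin 3) => w l q := by fun_prop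
    exact (hc'.tendsto x₀).comp hz
  have hnear : ∀ᶠ j in atTop, |x' j i τ - x j i τ| < κ / 2 := by
    have h := ((hco x' hx' i τ).sub (hco x hx i τ)).abs
    rw [sub_self, abs_zero] at h
    exact h.eventually (gt_mem_nhds (half_pos hκ))
  rcases hsep with hsep | hsep
  · -- the moving point BELOW the others: mirror at `m₀ = x₀ i τ + κ/2`
    refine tendsto_sub_of_move hc hG hu i τ hMove hx hx' hinj hdiff
      (cs := fun j => ⌊(x j i τ + κ / 2) / u j⌋) (m₀ := x₀ i τ + κ / 2)
      (tendsto_mul_floor_div hu ((hco x hx i τ).add_const _)) (fun h => by linarith)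
      (Or.inl fun l hl => ?_) ?_
    · have hlim : x₀ i τ + κ ≤ x₀ l τ := le_of_tendsto_of_tendsto ((hco x hx i τ).add_const κ)
        (hco x hx l τ) (Eventually.of_forall fun j => hsep j l hl)
      linarith
    · filter_upwards [hupos, hnear] with j hpos hnj
      refine Or.inl ⟨?_, ?_, fun l hl => ?_⟩ <;> rw [latticeApprox_apply] <;>
        refine Int.floor_le_floor (div_le_div_of_nonneg_right ?_ hpos.le)
      · linarith
      · linarith [(abs_lt.1 hnj).2]
      · linarith [hsep j l hl]
  · -- the moving point ABOVE the others: mirror at `m₀ = x₀ i τ - κ/2`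
    refine tendsto_sub_of_move hc hG hu i τ hMove hx hx' hinj hdiff
      (cs := fun j => ⌊(x j i τ - κ / 2) / u j⌋) (m₀ := x₀ i τ - κ / 2)
      (tendsto_mul_floor_div hu ((hco x hx i τ).sub_const _)) (fun h => by linarith)
      (Or.inr fun l hl => ?_) ?_
    · have hlim : x₀ l τ + κ ≤ x₀ i τ := le_of_tendsto_of_tendsto ((hco x hx l τ).add_const κ)
        (hco x hx i τ) (Eventually.of_forall fun j => hsep j l hl)
      linarith
    · filter_upwards [hupos, hnear] with j hpos hnj
      refine Or.inr ⟨?_, ?_, fun l hl => ?_⟩ <;> rw [latticeApprox_apply] <;>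
        refine Int.floor_le_floor (div_le_div_of_nonneg_right ?_ hpos.le)
      · linarith
      · linarith [(abs_lt.1 hnj).1]
      · linarith [hsep j l hl]

/-! ### The registered stub -/

/-- **STUB 1″b — REFLECTION-POSITIVITY TRANSFER: asymptotic equicontinuity under moves of a
COORDINATE-SEPARATED point (line `only-interaction-breaks-moebius`).** Granted the lattice move
inequality (the statement of `moveIneq_latticeRP`, taken as a hypothesis) and the two-point law
`⟨σ₀σ_y⟩_{β_c}‖y‖₂^{2Δ} → c > 0` (item 0634's data): along every mesh sequence `u k → 0⁺`, on every
compact set `K` of non-coincident `N`-point configurations, for every margin `κ > 0`, index `i` and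
coordinate `τ`, for every `ε > 0` there is `η > 0` such that eventually in `k`,
`|F_k x − F_k x'| < ε` whenever `x, x' ∈ K` differ only at the index `i`, `dist x x' < η`, and the
point `x i` is separated from all the other points by a slab of width `κ` in coordinate `τ`. Proof:
by contradiction along sequences (`equicontinuity_of_seq`, one orientation at a time) and the
sequential form `tendsto_sub_of_separated`: the move inequality with the lattice mirror at height
`⌊(x i τ ± κ/2)/δ⌋` bounds `(F_k x − F_k x')²` by `ρ²[G(v₀) − 2G(v₁) + G(v₂)] · ρ^{2(N−1)}⟨σ_{θB}σ_B⟩`;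
the bracket tends to `0` by the two-point law (three terms with a common limit) and the doubled
factor is eventually bounded by Newman's Gaussian inequality (`pinnedZoomLocallyBounded`) since the
limiting doubled configuration is non-coincident; `N = 0` is vacuous. [cite: FILS1978, §2]
[cite: DuminilCopinICM2022, §8.1 eq. (8.1)–(8.2)] -/
theorem sepMove_equicontinuity :
    (∀ (τ : Fin 3) (c : ℤ) (n : ℕ) (i : Fin (n + 1)) (y y' : Fin (n + 1) → Site 3),
      (∀ j, j ≠ i → y' j = y j) →
      ((y i τ ≤ c ∧ y' i τ ≤ c ∧ ∀ j, j ≠ i → c ≤ y j τ) ∨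
        (c ≤ y i τ ∧ c ≤ y' i τ ∧ ∀ j, j ≠ i → y j τ ≤ c)) →
      (criticalCorr 3 (n + 1) y - criticalCorr 3 (n + 1) y') ^ 2 ≤
        (criticalTwoPoint 3 (y i - Function.update (y i) τ (2 * c - y i τ))
          - 2 * criticalTwoPoint 3 (y i - Function.update (y' i) τ (2 * c - y' i τ))
          + criticalTwoPoint 3 (y' i - Function.update (y' i) τ (2 * c - y' i τ))) *
        criticalCorr 3 (n + n)
          (Fin.append (fun j => Function.update (y (i.succAbove j)) τ (2 * c - y (i.succAbove j) τ))
            (fun j => y (i.succAbove j)))) →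
    ∀ (Δ c : ℝ), 0 < c →
      Tendsto (fun y : Site 3 => criticalTwoPoint 3 y * Real.sqrt (∑ i, ((y i : ℝ)) ^ 2) ^ (2 * Δ))
        cofinite (𝓝 c) →
      ∀ u : ℕ → ℝ, Tendsto u atTop (𝓝[>] (0 : ℝ)) →
        ∀ (N : ℕ) (K : Set (Fin N → EuclideanSpace ℝ (Fin 3))), IsCompact K → K ⊆ NonCoincident 3 N →
          ∀ κ : ℝ, 0 < κ → ∀ (i : Fin N) (τ : Fin 3), ∀ ε > 0, ∃ η > 0, ∀ᶠ k in atTop, ∀ x ∈ K, ∀ x' ∈ K,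
            (∀ j, j ≠ i → x' j = x j) →
            ((∀ j, j ≠ i → x i τ + κ ≤ x j τ) ∨ (∀ j, j ≠ i → x j τ + κ ≤ x i τ)) →
            dist x x' < η →
              |rescaledCorrelator (criticalCorr 3) rhoPin N (u k) x -
                rescaledCorrelator (criticalCorr 3) rhoPin N (u k) x'| < ε := by
  intro hMove Δ c hc hG u hu N K hK hKs κ hκ i τ ε hε
  cases N with
  | zero => exact i.elim0
  | succ n =>
    -- one orientation at a time, by contradiction along sequences
    have key : ∀ S : (Fin (n + 1) → EuclideanSpace ℝ (Fin 3)) → Prop,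
        ((S = fun x => ∀ j, j ≠ i → x i τ + κ ≤ x j τ) ∨
          (S = fun x => ∀ j, j ≠ i → x j τ + κ ≤ x i τ)) →
        ∃ η > 0, ∀ᶠ k in atTop, ∀ x ∈ K, ∀ x' ∈ K, ((∀ j, j ≠ i → x' j = x j) ∧ S x) →
          dist x x' < η →
            |rescaledCorrelator (criticalCorr 3) rhoPin (n + 1) (u k) x -
              rescaledCorrelator (criticalCorr 3) rhoPin (n + 1) (u k) x'| < ε := by
      intro S hS
      refine equicontinuity_of_seq (n + 1) K hK (fun x x' => (∀ j, j ≠ i → x' j = x j) ∧ S x)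
        (fun k => rescaledCorrelator (criticalCorr 3) rhoPin (n + 1) (u k)) ?_ ε hε
      intro x x' x₀ hx₀ hP hx hx' φ hφ
      refine tendsto_sub_of_separated hc hG (hu.comp hφ.tendsto_atTop) i τ (hMove τ · n i) hκ
        hx hx' ((mem_nonCoincident x₀).1 (hKs hx₀)) (fun j => (hP j).1) ?_
      rcases hS with rfl | rfl
      · exact Or.inl fun j => (hP j).2
      · exact Or.inr fun j => (hP j).2
    obtain ⟨η₁, hη₁, h₁⟩ := key _ (Or.inl rfl)
    obtain ⟨η₂, hη₂, h₂⟩ := key _ (Or.inr rfl)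
    refine ⟨min η₁ η₂, lt_min hη₁ hη₂, ?_⟩
    filter_upwards [h₁, h₂] with k hk₁ hk₂ x hx x' hx' hdiff hsep hdist
    rcases hsep with hsep | hsep
    · exact hk₁ x hx x' hx' ⟨hdiff, hsep⟩ (lt_of_lt_of_le hdist (min_le_left _ _))
    · exact hk₂ x hx x' hx' ⟨hdiff, hsep⟩ (lt_of_lt_of_le hdist (min_le_right _ _))

end Summit.CriticalPhenomena.Ising3DConformalLimit.MoebiusLimitExistsOnlyInteraction

end
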